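import Mathlib.Combinatorics.Colex
import Literature.Computability.Complexity.ConstantDepth
import HarnessLib

/-!
# `SYM⁺` circuits and the Yao–Beigel–Tarui representation of `ACC⁰` (trunk CplxCore)

A `SYM⁺` circuit (Beigel–Tarui 1994; Williams 2014, §2: "a depth-two circuit which computes some
symmetric function at the output gate, and computes ANDs of input variables on the second
layer") on the input variables `Fin n` is given by a list of AND-terms — finite sets of input
variables, repetitions allowed, the empty term being the constant `1` — and a symmetric output
gate, i.e. a function of the NUMBER of satisfied terms (`SymPlus`, `SymPlus.eval`). Equivalently
(Beigel–Tarui 1994, §1.3) it is a function `h (r x)` of the value of a polynomial `r` over `ℤ`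
with non-negative coefficients (the multiplicities) evaluated at the `0/1`-input `x`.

The file vendors, as a named fact over the tree's circuit model, the representation theorem
behind Williams' `ACC`-SAT algorithm (`Williams2014.lean`, fact `Williams2014_accSat_polysize`):

* `Williams2014_symPlus_of_acc` — every `AC⁰[m]` circuit of depth `d` with `n ≤ s` inputs, at
  most `s` gates and fan-in at most `s` is equivalent to a `SYM⁺` circuit with at most
  `2 ^ ((log₂ s + 2) ^ e)` terms, each of at most `(log₂ s + 2) ^ e` variables, for a constant
  `e = e(d, m)` (Yao 1990; Beigel–Tarui 1994, Thm. 1.1: "`ACC ⊆ SYM⁺`", with `2^{log^{O(1)} n}`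
  AND gates of fan-in `log^{O(1)} n`; Allender–Gore 1994; in the per-circuit quantitative form
  of Williams 2014, Lemma 4.1 and Appendix A: an `ACC` circuit of depth `d` and size `s` has an
  equivalent `SYM⁺` circuit of `s^{O(log^{f(d)} s)}` size whose ANDs have `poly(log s)` fan-in).
  This is the existence half of Williams' Lemma 4.1; the other half (the conversion and the
  symmetric function are computable in the same time bound) is a statement about machines and
  is left to the discharge of `Williams2014_accSat_polysize`.

API: `SymPlus.count`/`eval`/`size`/`maxFanIn`, the one-variable terms `SymPlus.singletons`
(whose count is the number of ones, `SymPlus.count_singletons`, so that every symmetric gate —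
`∧ₖ`, `∨ₖ`, `MODₘ`, `MAJ`, parity — is a `SYM⁺` circuit with `k` terms of fan-in `1`,
e.g. `SymPlus.eval_paritySymPlus`), and `SymPlus.exists_eval_eq`: EVERY Boolean function is a
`SYM⁺` circuit with one-variable terms (binary-weighted multiplicities, `2ⁿ - 1` terms), proved
with Mathlib's `Finset.geomSum_injective` — so the representation theorem is purely
quantitative.

## Faithfulness notes

* Terms are ANDs of (positive) input variables, as printed in Williams 2014, §2, and the output
  gate is an arbitrary function `ℕ → Bool` of the number of true terms. Negations cost nothing
  in this format: every Boolean function is some `SYM⁺` circuit (`SymPlus.exists_eval_eq`; in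
  Williams, App. A, Transformation 4, signs are absorbed by counting modulo `pᵏ`), so the
  content of the theorem is the quasi-polynomial size and polylogarithmic fan-in.
* Williams measures circuit size by wires; the hypotheses `n ≤ s`, `size ≤ s` (gates),
  `maxFanIn ≤ s` give at most `s²` wires, and `s^{O(log^f s)} = 2^{O((log s)^{f+1})}` is
  insensitive to squaring `s`; the single exponent `e` absorbs all constants
  (`c (log₂ s)^{f+1} + c ≤ (log₂ s + 2)^e` once `2^{e-f-1} ≥ c`).
* The modulus `m ≥ 2` is arbitrary (composite allowed: Beigel–Tarui 1994, Thm. 1.1 is for all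
  of `ACC`; Williams, App. A, Transformation 1 factors `m`); `e` depends on `d` and `m`.

## References

* R. Beigel, J. Tarui, *On ACC*, Comput. Complexity 4 (1994) 350–366, §1.3 (definition of
  `SYM⁺`), Thm. 1.1 [BeigelTarui1994].
* R. Williams, *Nonuniform ACC circuit lower bounds*, J. ACM 61 (2014), §2 (`SYM⁺`), Lemma 4.1,
  Appendix A [Williams2014].
* A. C.-C. Yao, *On ACC and threshold circuits*, FOCS 1990; E. Allender, V. Gore, *A uniform
  circuit lower bound for the permanent*, SIAM J. Comput. 23 (1994).
-/

namespace Literature.Computability.Complexity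

open Finset

/-! ### `SYM⁺` circuits -/

/-- A `SYM⁺` circuit on the input variables `Fin n`: a list of AND-terms (finite sets of input
variables; repetitions allowed, the empty set is the constant-`1` term) feeding a symmetric
output gate, recorded as a function `sym` of the number of satisfied terms (Beigel–Tarui 1994,
§1.3; Williams 2014, §2: "a depth-two circuit which computes some symmetric function at the
output gate, and computes ANDs of input variables on the second layer"). [cite: BeigelTarui1994, §1.3] -/
structure SymPlus (n : ℕ) where
  /-- The AND-terms: sets of input variables. -/
  terms : List (Finset (Fin n))
  /-- The symmetric output gate, as a function of the number of true terms. -/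
  sym : ℕ → Bool

namespace SymPlus

variable {n : ℕ}

/-- The number of AND-terms of `S` satisfied by the input `x` (the integer fed to the symmetric
gate; Williams 2014, Lemma 4.1: "the number of ANDs in the circuit that evaluate to 1"). [cite: Williams2014, Lemma 4.1] -/
def count (S : SymPlus n) (x : Fin n → Bool) : ℕ :=
  S.terms.countP fun t => decide (∀ i ∈ t, x i = true)

/-- The value of a `SYM⁺` circuit: the symmetric gate applied to the number of true AND-terms
(Beigel–Tarui 1994, §1.3). [cite: BeigelTarui1994, §1.3] -/
def eval (S : SymPlus n) (x : Fin n → Bool) : Bool :=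
  S.sym (S.count x)

/-- The size of a `SYM⁺` circuit: its number of AND-terms (Williams 2014, §4).
[cite: Williams2014, Lemma 4.1] -/
def size (S : SymPlus n) : ℕ := S.terms.length

/-- The largest fan-in of an AND-term (`0` if there are no terms) (Beigel–Tarui 1994, Thm. 1.1:
"AND gates of fan-in `log^{O(1)} n`"). [cite: BeigelTarui1994, Thm. 1.1] -/
def maxFanIn (S : SymPlus n) : ℕ := (S.terms.map Finset.card).foldr max 0

/-- The count never exceeds the number of terms. [folklore] -/
theorem count_le_size (S : SymPlus n) (x : Fin n → Bool) : S.count x ≤ S.size :=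
  List.countP_le_length

/-- Every term has fan-in at most `maxFanIn`. [folklore] -/
theorem card_le_maxFanIn (S : SymPlus n) {t : Finset (Fin n)} (ht : t ∈ S.terms) :
    t.card ≤ S.maxFanIn := by
  unfold maxFanIn
  obtain ⟨terms, sym⟩ := S
  simp only at ht ⊢
  induction terms with
  | nil => simp at ht
  | cons u terms ih =>
    simp only [List.map_cons, List.foldr_cons]
    rcases List.mem_cons.1 ht with rfl | h
    · exact le_max_left _ _
    · exact (ih h).trans (le_max_right _ _)

/-- `maxFanIn ≤ K` as soon as every term has at most `K` variables. [folklore] -/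
theorem maxFanIn_le {S : SymPlus n} {K : ℕ} (h : ∀ t ∈ S.terms, t.card ≤ K) : S.maxFanIn ≤ K := by
  unfold maxFanIn
  obtain ⟨terms, sym⟩ := S
  simp only at h ⊢
  induction terms with
  | nil => simp
  | cons u terms ih =>
    simp only [List.map_cons, List.foldr_cons]
    exact max_le (h u (by simp)) (ih fun t ht => h t (by simp [ht]))

/-! ### Every Boolean function is a `SYM⁺` circuit (of exponential size) -/

/-- Binary-weighted one-variable terms: the term `{i}` repeated `2 ^ i` times, so that the number
of true terms is the binary number `∑ {2 ^ i | x i = 1}` and determines the input. [folklore] -/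
def binaryTerms (n : ℕ) : List (Finset (Fin n)) :=
  (List.finRange n).flatMap fun i : Fin n => List.replicate (2 ^ i.val) ({i} : Finset (Fin n))

/-- The count of `binaryTerms` is the binary number with digits `x`. [folklore] -/
theorem countP_binaryTerms (x : Fin n → Bool) :
    (binaryTerms n).countP (fun t => decide (∀ i ∈ t, x i = true)) =
      ∑ i ∈ univ.filter (fun i : Fin n => x i = true), 2 ^ (i : ℕ) := by
  simp only [binaryTerms, List.countP_flatMap, List.countP_replicate, Function.comp_def,
    Finset.mem_singleton, forall_eq, Finset.sum_filter]
  rw [Fin.univ_def, Finset.sum_mk, Multiset.map_coe, Multiset.sum_coe]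
  congr 1
  refine List.map_congr_left fun i _ => ?_
  by_cases hx : x i = true <;> simp [hx]

/-- The binary number with digits `x` determines `x`. [folklore] -/
theorem binarySum_injective :
    Function.Injective fun x : Fin n → Bool =>
      ∑ i ∈ univ.filter (fun i : Fin n => x i = true), 2 ^ (i : ℕ) := by
  intro x y h
  have key : ∀ z : Fin n → Bool, ∑ i ∈ univ.filter (fun i : Fin n => z i = true), 2 ^ (i : ℕ) =
      ∑ j ∈ (univ.filter fun i : Fin n => z i = true).map Fin.valEmbedding, 2 ^ j := fun z => by
    rw [Finset.sum_map]
    rfl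
  simp only at h
  rw [key x, key y] at h
  have h2 := Finset.map_injective Fin.valEmbedding (Finset.geomSum_injective le_rfl h)
  funext i
  have hi := Finset.ext_iff.1 h2 i
  simp only [Finset.mem_filter, Finset.mem_univ, true_and] at hi
  cases hx : x i <;> cases hy : y i
  · rfl
  · exact absurd (hi.2 hy) (by rw [hx]; exact Bool.false_ne_true)
  · exact absurd (hi.1 hx) (by rw [hy]; exact Bool.false_ne_true)
  · rfl

/-- **Every Boolean function is computed by some `SYM⁺` circuit**, indeed one with one-variable
terms (and `2ⁿ - 1` of them): positivity of the AND-terms is no restriction, the symmetric gate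
reads the input off the binary-weighted count. So the content of `ACC ⊆ SYM⁺` is quantitative
(quasi-polynomial size). [folklore] -/
theorem exists_eval_eq (f : (Fin n → Bool) → Bool) :
    ∃ S : SymPlus n, S.maxFanIn ≤ 1 ∧ ∀ x, S.eval x = f x := by
  classical
  let enc : (Fin n → Bool) → ℕ := fun x =>
    (binaryTerms n).countP fun t => decide (∀ i ∈ t, x i = true)
  have henc : Function.Injective enc := by
    intro x y h
    refine binarySum_injective ?_
    simp only
    rw [← countP_binaryTerms, ← countP_binaryTerms]
    exact h
  refine ⟨⟨binaryTerms n, fun v => f (Function.invFun enc v)⟩, maxFanIn_le ?_, fun x => ?_⟩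
  · intro t ht
    simp only [binaryTerms, List.mem_flatMap, List.mem_replicate] at ht
    obtain ⟨i, -, -, rfl⟩ := ht
    simp
  · show f (Function.invFun enc (enc x)) = f x
    rw [Function.leftInverse_invFun henc x]

/-! ### Symmetric gates are `SYM⁺` circuits of fan-in one -/

/-- The `SYM⁺` circuit with the `n` one-variable terms `{0}, …, {n-1}` and symmetric gate `sym`:
its count is the number of ones of the input, so it computes the symmetric Boolean function
`x ↦ sym (#ones x)` (Beigel–Tarui 1994, §1.3: a symmetric-function gate "only depends on the
number of inputs that are 1"). [cite: BeigelTarui1994, §1.3] -/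
def singletons (n : ℕ) (sym : ℕ → Bool) : SymPlus n :=
  ⟨(List.finRange n).map fun i => {i}, sym⟩

/-- `singletons` has `n` terms. [folklore] -/
@[simp] theorem size_singletons (n : ℕ) (sym : ℕ → Bool) : (singletons n sym).size = n := by
  simp [singletons, size]

/-- The count of `singletons` is the number of ones of the input (`GateFn.numOnes`). [folklore] -/
theorem count_singletons (n : ℕ) (sym : ℕ → Bool) (x : Fin n → Bool) :
    (singletons n sym).count x = GateFn.numOnes x := by
  simp only [count, singletons, List.countP_map, GateFn.numOnes, Function.comp_def,
    Finset.mem_singleton, forall_eq]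
  rw [Fin.univ_def, Finset.card_def, Finset.filter_val]
  change _ = Multiset.card (Multiset.filter _ (↑(List.finRange n) : Multiset (Fin n)))
  rw [Multiset.filter_coe, Multiset.coe_card, List.countP_eq_length_filter]

/-- `singletons n sym` computes the symmetric function `x ↦ sym (#ones x)`. [folklore] -/
theorem eval_singletons (n : ℕ) (sym : ℕ → Bool) (x : Fin n → Bool) :
    (singletons n sym).eval x = sym (GateFn.numOnes x) := by
  rw [eval, count_singletons]
  rfl

/-- Every term of `singletons` is a single variable: fan-in at most `1`. [folklore] -/
theorem maxFanIn_singletons_le (n : ℕ) (sym : ℕ → Bool) : (singletons n sym).maxFanIn ≤ 1 := by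
  unfold maxFanIn singletons
  simp only [List.map_map]
  induction List.finRange n with
  | nil => simp
  | cons i l ih =>
    simp only [List.map_cons, List.foldr_cons, Function.comp_apply, Finset.card_singleton]
    exact max_le le_rfl ih

/-- The parity function `PARITYₙ` as a `SYM⁺` circuit: `n` one-variable terms and the gate
"odd" (Beigel–Tarui 1994, §1.1: parity versus `ACC`). [cite: BeigelTarui1994, §1.3] -/
def paritySymPlus (n : ℕ) : SymPlus n := singletons n fun v => decide (v % 2 = 1)

/-- `paritySymPlus n` computes `parityFn n`. [folklore] -/
theorem eval_paritySymPlus (n : ℕ) : (paritySymPlus n).eval = parityFn n := by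
  funext x
  rw [paritySymPlus, eval_singletons]
  rfl

/-- The gate `MODₘ` of arity `k` (tree convention: true iff the number of ones is NOT divisible
by `m`) as a `SYM⁺` circuit with `k` one-variable terms. [folklore] -/
theorem eval_singletons_modGate (m k : ℕ) :
    (singletons k fun v => decide (v % m ≠ 0)).eval = (GateFn.modGate m k).2 := by
  funext x
  rw [eval_singletons]
  rfl

end SymPlus

/-! ### `ACC⁰ ⊆ SYM⁺`: the representation theorem (Yao, Beigel–Tarui, Allender–Gore) -/

/-- **Every `ACC⁰` circuit is a quasi-polynomial-size `SYM⁺` circuit of polylogarithmic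
fan-in** (Yao 1990; Beigel–Tarui 1994, Thm. 1.1: "`ACC ⊆ SYM⁺`", i.e. "every language `L` in
the class `ACC` can be recognized by depth-two deterministic circuits with a symmetric-function
gate at the root and `2^{log^{O(1)} n}` AND gates of fan-in `log^{O(1)} n` at the leaves";
per-circuit quantitative form as in Williams 2014, Lemma 4.1 with Appendix A: "given an ACC
circuit of depth `d` and size `s`, [one obtains] an equivalent `SYM⁺` circuit of
`s^{O(log^{f(d)} s)}` size", whose ANDs have fan-in `poly(log s)` (App. A, Transformations 3–4)).
Statement: for every depth `d` and modulus `m ≥ 2` there is an exponent `e` such that every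
circuit `C` over `accBasis m` with `acDepth C ≤ d`, on `n ≤ s` inputs, with at most `s` gates
of fan-in at most `s`, has an equivalent `SYM⁺` circuit with at most `2 ^ ((log₂ s + 2) ^ e)`
terms, each of at most `(log₂ s + 2) ^ e` variables (`log₂ = Nat.log 2`; the shift `+ 2` and the
single exponent `e` absorb the `O`-constants, see the module docstring). Only the existence of
the `SYM⁺` circuit is asserted, not the running time of the conversion (the other half of
Williams' Lemma 4.1). [cite: Williams2014, Lemma 4.1 and Appendix A] [cite: BeigelTarui1994, Thm. 1.1] -/
def Williams2014_symPlus_of_acc : Prop :=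
  ∀ d m : ℕ, 2 ≤ m → ∃ e : ℕ, ∀ (n s : ℕ) (C : Circuit (Fin n)), C.IsOver (accBasis m) →
    C.acDepth ≤ d → n ≤ s → C.size ≤ s → C.maxFanIn ≤ s →
      ∃ S : SymPlus n, S.size ≤ 2 ^ (Nat.log 2 s + 2) ^ e ∧ S.maxFanIn ≤ (Nat.log 2 s + 2) ^ e ∧
        ∀ x, S.eval x = C.eval x

end Literature.Computability.Complexity
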